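import Summits.QuantumFields.BalabanUV.Beta.GAN24.Lin4SlotDivergence
import Summits.QuantumFields.BalabanUV.Beta.GAN24.T2RecChargeStep
import Summits.QuantumFields.BalabanUV.Beta.WardLocusQuarticTable

/-!
# `BalabanUV.Beta.GAN24.T2SlavedDivergence` — binder row G-an2-4 ∕ (CONV-C), CT-route «WC-TL» (RULING R-gan24p1-g24-1, journal l.38843; design
# `gen24/CT-W-DESIGN-v2.md` §2 (SLAVE), row SLAVE-src): **THE SOURCE-SLOT DIVERGENCE OF THE DRESSED COMB MEMBER ONE LEVEL UP IS SLAVED TO LEVEL-`j`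
# FIRST-ORDER DATA** — T-EQ (leaf-03 g58's `Lin4SlotDivergence.divW_lin4_comb`) on p2's (F1) affine step, composed with the D1 swarm's TABLE LAWS
# (`WardLocusQuarticTable.tableLaw_T2RecAt_succ ∕ _zero`, hypotheses displayed verbatim)

NOT IN PRINT; OUR BOOKKEEPING (G-an2-4 crux team (2), leaf prover `b2b-balaban-gan24-formalise-leaf-06`, gen 43; journal [GAN24LEAF06-G43-INTENT5]).  [folklore]
compositions BY NAME over EXISTING objects; 0 `def`, 0 cite, 0 `def … : Prop`, 0 sorry.  SLAVE-src, SOURCE SLOTS, COMPLETE: §0–§3 the member side, the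
unit-currency plumbing and the composition with the table laws AS LETTERS; §4 the instances at D1's literal `tableLaw_T2RecAt_succ ∕ '' ∕ _zero ∕ ''` under THEIR displayed
hypotheses (`h𝒩 hWd hlock hBord hBord''` at level `m+1`, the Wilson∕border letters at level `0`) — nothing new assumed.

WHAT (comb literal `T̃_j := T2RecAt d Lc (toSite r) cE cVH cΛ cE₂ cB Tc vh₂S (mixFFAt ρ Lc) j`, unit member `T♮̃_j := unitS₂ (sfStep Lc j) (smStep d Lc j) T̃_j`, dressed unit
kernel `K♮ᴱ_j := unitK_j (coDressKBmAt ρ Lc (KInvStep Lc j))`, `c := cE₂·Lc^{2(d+1)}`; in-block root, `1 ≤ Lc`; an1's border data `hBff hBmm hB`):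
§0 `divW_add_apply` — `KernelWard.divW` is additive.
§1 **`divW_member_succ_eq`** — T-EQ ON THE MEMBER: `divW (T♮̃_{j+1}) y ν y′ = divW (b♮̃_j) y ν y′ + (c·Lc^{−(d+1)}∕2) • (e3OfK Lc K♮ᴱ_j F₁ ν y′ + e3OfK Lc K♮ᴱ_j F₂ ν y′)`,
   `F₁ ∕ F₂` the two BLOCK-SUMMED source-slot divergences of `T♮̃_j`, `b♮̃_j` p2's (F1) source (NO member inside) — p2's `unitS₂_T2RecOf_succ_eq_lin4_add` at the comb
   letters + leaf-03 g58's `Lin4SlotDivergence.divW_lin4_comb` (T-EQ of record).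
§2 `boxSum_divV_unitS₂_fst ∕ _snd` — the block-summed slot divergences of a `unitS₂`-normalised table are the `unitS`-rescaled raw ones (`divV` acts on the slot, the
   units on the legs); `…_of_tableLaw` — hence, under a RAW table law `cH′ • Σ_v divV (…) (Lc•Y + v) = S ∘ X_Y − X_Y ∘ S + R Y` (the LITERAL conclusion shape of D1's
   `WardLocusQuarticTable.tableLaw_T2RecAt_succ ∕ _zero`, resp. their `''` twins), `F₁ = (sf·sm)⁻¹ • unitS sf sm (κ′ u′ ↦ cH′⁻¹ • (S κ′ u′ ∘ X_y − X_y ∘ S κ′ u′ + R y κ′ u′))`.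
§3 **`divW_member_succ_eq_slaved`** = §1 ∘ §2: with the two table laws of the RAW member `T̃_j` as hypotheses (letters `S X R R″ cH′`, `cH′ ≠ 0`),
   `divW (T♮̃_{j+1}) y ν y′ = divW (b♮̃_j) y ν y′ + (c·Lc^{−(d+1)}∕2) • (e3OfK Lc K♮ᴱ_j [unit-rescaled `cH′⁻¹ • (S ∘ X_y − X_y ∘ S + R y)`] ν y′ + the ″ twin)` —
   **THE SOURCE-SLOT DIVERGENCE OF THE MEMBER ONE LEVEL UP IS AN EXPLICIT FUNCTION OF LEVEL-`j` FIRST-ORDER DATA AND OF `divW (b♮̃_j)`; THE MEMBER IS GONE**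
   (design v2 §2 (SLAVE), source slots; OWNER W11 l.39039: unit currency, this shape).
§4 **`divW_member_succ_succ_eq_slaved`** (level `m+1 → m+2`: `hTL ∕ hTL″` DISCHARGED by D1-leaf-06's `tableLaw_T2RecAt_succ ∕ ''` under their `h𝒩 hWd hlock hBord hBord''`)
   and **`divW_member_one_eq_slaved`** (level `0 → 1`: by `tableLaw_T2RecAt_zero ∕ ''` under the Wilson letters `hWil ∕ hWil''` and border letters `hBord ∕ hBord''`);
   pin `(cE, cVH) = (Lc^{d+1}, −Lc^{d+1}·½·Lc^{d+1})`, `cH′ ≠ 0` displayed (it follows from the lock; not derived here).  OWNER R8 (E9′), l.39177: on the engine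
   `R_0 = 0` exactly and `R_1` lives in the ff legs only.
Asserts NOTHING about Bałaban's tables; 0 estimate; the table laws are LETTERS in §3 and D1's THEOREMS in §4 (whose own hypotheses — the level-`m` KERNEL law `hWd`, the lock, the border ∕ Wilson letters — stay displayed);
decides nothing about (Q-R) ∕ (C) ∕ «T2Shape» ∕ «T2Drift» ∕ (hW, hWall); NEVER «G-an2-4 closed» as (CONV-C); NOT D1, NOT `BetaPertH`, NOT continuum, NOT Clay.  2026-08-22.
-/

noncomputable section

open Finset
open scoped BigOperators
open Literature.MathematicalPhysics.QuantumFieldTheory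
open Literature.MathematicalPhysics.QuantumFieldTheory.Balaban1983to89
open Literature.MathematicalPhysics.QuantumFieldTheory.Balaban1983to89.Beta
open ExpKernelCalculus (MKer Decays comp)
open OneStepResolventKernel (Fib)
open OneStepKernelFamily (KInvStep)
open SecondOrderResponse (W2SymOfK)
open BalabanStepJetsSucc (mmRead)
open BalabanStepW2 (K3OfK M2Of)
open KernelWard (divV divW)
open AffineAveraging (box toSite)
open BalabanCompositeJets (LocStencil₂)
open AveragingMixedJetTables (mixFFAt)
open Summit.QuantumFields.BalabanUV.Beta.HessKerDressedUnits (unitK unitS unitS_apply legScale decays_unitK)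
open Summit.QuantumFields.BalabanUV.Beta.SecondOrderUnits (unitM unitS₂ unitM₂)
open Summit.QuantumFields.BalabanUV.Beta.AxialDressingRooted (coDressKBmAt decays_coDressKBmAt_KInvStep)
open Summit.QuantumFields.BalabanUV.Beta.SpineRooted (T2RecOf T2RecAt SpureRecAt M1At T2RecOf_comb e3OfK locStencil_SpureRecAt vertexFamily_M1At)
open Summit.QuantumFields.BalabanUV.Beta.MixedJetTablesPlug (hmix_an1)
open Summit.QuantumFields.BalabanUV.Beta.GAN24.CombesThomas (sfStep smStep)
open Summit.QuantumFields.BalabanUV.Beta.GAN24.T2RecursionAffine (lin4)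
open Summit.QuantumFields.BalabanUV.Beta.GAN24.T2SlotUnits (unitS₂_apply)
open Summit.QuantumFields.BalabanUV.Beta.GAN24.BiStencilZeroMode (Tab)
open Summit.QuantumFields.BalabanUV.Beta.GAN24.Lin4ZeroMode (bdd_of_locStencil₂)
open Summit.QuantumFields.BalabanUV.Beta.GAN24.T2RecOfUnitSplit (unitS₂_T2RecOf_succ_eq_lin4_add step_data_of_letters)
open Summit.QuantumFields.BalabanUV.Beta.GAN24.T2RecChargeStep (shape_member)
open Summit.QuantumFields.BalabanUV.Beta.GAN24.Lin4SlotDivergence (divW_lin4_comb)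

open SecondOrderResponse (dM)
open BalabanStepJetsSucc (wE wVH)
open BalabanStepW2 (wV4 wB2)
open AveragingHessianKernelsRooted (vhSAt)
open StepJetData (wilsonA)
open WilsonBiStencil (wilsonW₂)
open Summit.QuantumFields.BalabanUV.Beta.SpineRooted (WrecAt)
open Summit.QuantumFields.BalabanUV.Beta.ChartConjugation (conjV)
open Summit.QuantumFields.BalabanUV.Beta.TameKernelCalculus
open Summit.QuantumFields.BalabanUV.Beta.BorderedHessian (diagK)
open Summit.QuantumFields.BalabanUV.Beta.AveragingWardRootedStencils (legInd)
open Summit.QuantumFields.BalabanUV.Beta.WardLocusQuarticTable (tableLaw_T2RecAt_succ tableLaw_T2RecAt_succ'' tableLaw_T2RecAt_zero tableLaw_T2RecAt_zero'')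

namespace Summit.QuantumFields.BalabanUV.Beta.GAN24.T2SlavedDivergence

variable {d : ℕ} {Lc : ℕ} [NeZero Lc] {r : Fin (d + 1) → ℕ}

/-! ## §0 `divW` is additive -/

omit [NeZero Lc] in
/-- [folklore] The pure-gauge slice `divW` of a sum of second-order tables is the sum of the slices. -/
theorem divW_add_apply (A B : Tab d) (y : Fin (d + 1) → ℤ) (ν : Fin (d + 1)) (y' : Fin (d + 1) → ℤ) :
    divW (A + B) y ν y' = divW A y ν y' + divW B y ν y' := by
  simp only [KernelWard.divW, Pi.add_apply, ← Finset.sum_add_distrib]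
  exact Finset.sum_congr rfl fun μ _ => by abel

/-! ## §1 T-EQ on the member: the source-slot divergence one level up reads the member only through its two BLOCK-SUMMED slot divergences -/

/-- NOT IN PRINT; OUR BOOKKEEPING.  **T-EQ ON THE DRESSED COMB MEMBER** (every `j`, every coarse `y ν y′`; in-block root, `1 ≤ Lc`; an1's border data
`hBff hBmm hB`, `mixFFAt`): with `T♮̃_j := unitS₂_j (T2RecAt … j)`, `K♮ᴱ_j := unitK_j (coDressKBmAt ρ Lc (KInvStep Lc j))`, `c := cE₂·Lc^{2(d+1)}` and p2's (F1)
source `b♮̃_j` (the `K3OfK`-sandwich of `W2SymOfK K♮ᴱ_j Lc S♮_j M♮_j 0 M₂♮_j` — NO member inside — plus `cB • vh₂S`):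
`divW (T♮̃_{j+1}) y ν y′ = divW (b♮̃_j) y ν y′ + (c·(Lc^{d+1})⁻¹∕2) • (e3OfK Lc K♮ᴱ_j F₁ ν y′ + e3OfK Lc K♮ᴱ_j F₂ ν y′)`, `F₁ κ′ u′ := Σ_{v∈box} divV (κ u ↦ T♮̃_j κ u κ′ u′) (Lc•y + v)`,
`F₂ κ u := Σ_v divV (T♮̃_j κ u) (Lc•y + v)` — p2's `unitS₂_T2RecOf_succ_eq_lin4_add` (comb letters discharged as in `T2RecChargeStep`) + leaf-03's `divW_lin4_comb`. -/
theorem divW_member_succ_eq (hLc : 1 ≤ Lc) (hr : r ∈ box (d + 1) Lc) (cE cVH cΛ cE₂ cB : ℝ) (Tc : Fin 4 → Fin 4 → Fin 4 → Fin 4 → ℝ)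
    {vh₂S : Tab d} (hBff : ∀ κ u κ' u' x z (α β : Fin (d + 1)), vh₂S κ u κ' u' x z (Sum.inl α) (Sum.inl β) = 0)
    (hBmm : ∀ κ u κ' u' x z (μ ν : Fin (d + 1)), vh₂S κ u κ' u' x z (Sum.inr μ) (Sum.inr ν) = 0)
    (hB : ∃ C δ : ℝ, 0 < δ ∧ LocStencil₂ vh₂S C δ) (j : ℕ) (y : Fin (d + 1) → ℤ) (ν : Fin (d + 1)) (y' : Fin (d + 1) → ℤ) :
    divW (unitS₂ (sfStep Lc (j + 1)) (smStep d Lc (j + 1)) (T2RecAt d Lc (toSite r) cE cVH cΛ cE₂ cB Tc vh₂S (mixFFAt (toSite r) Lc) (j + 1))) y ν y'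
      = divW (fun κ u κ' u' => (cE₂ * (Lc : ℝ) ^ (2 * (d + 1))) • mmRead Lc (K3OfK
            (unitK (sfStep Lc j) (smStep d Lc j) (coDressKBmAt (toSite r) Lc (KInvStep (d := d) Lc j))) Lc
            (unitS (sfStep Lc j) (smStep d Lc j) (SpureRecAt d Lc (toSite r) cE cVH cΛ j)) (unitM (sfStep Lc j) (smStep d Lc j) (M1At d Lc (toSite r) cΛ j))
            (W2SymOfK (unitK (sfStep Lc j) (smStep d Lc j) (coDressKBmAt (toSite r) Lc (KInvStep (d := d) Lc j))) Lc
              (unitS (sfStep Lc j) (smStep d Lc j) (SpureRecAt d Lc (toSite r) cE cVH cΛ j)) (unitM (sfStep Lc j) (smStep d Lc j) (M1At d Lc (toSite r) cΛ j)) 0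
              (unitM₂ (sfStep Lc j) (smStep d Lc j) (M2Of d Lc (mixFFAt (toSite r) Lc) j))) κ u κ' u') + cB • vh₂S κ u κ' u') y ν y'
        + (cE₂ * (Lc : ℝ) ^ (2 * (d + 1)) * ((Lc : ℝ) ^ (d + 1))⁻¹ / 2) •
          (e3OfK Lc (unitK (sfStep Lc j) (smStep d Lc j) (coDressKBmAt (toSite r) Lc (KInvStep (d := d) Lc j)))
              (fun κ' u' => ∑ v ∈ box (d + 1) Lc, divV (fun κ u =>
                unitS₂ (sfStep Lc j) (smStep d Lc j) (T2RecAt d Lc (toSite r) cE cVH cΛ cE₂ cB Tc vh₂S (mixFFAt (toSite r) Lc) j) κ u κ' u')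
                ((Lc : ℤ) • y + toSite v)) ν y'
            + e3OfK Lc (unitK (sfStep Lc j) (smStep d Lc j) (coDressKBmAt (toSite r) Lc (KInvStep (d := d) Lc j)))
              (fun κ u => ∑ v ∈ box (d + 1) Lc, divV
                (unitS₂ (sfStep Lc j) (smStep d Lc j) (T2RecAt d Lc (toSite r) cE cVH cΛ cE₂ cB Tc vh₂S (mixFFAt (toSite r) Lc) j) κ u)
                ((Lc : ℤ) • y + toSite v)) ν y') := by
  -- p2's (F1) step at the comb letters (as in `T2RecChargeStep.succ_eq_lin4_dress_add`, before the dressing is moved onto the table)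
  obtain ⟨C, δ, C₀, C₁, hδ, hK, h₀, hW⟩ := step_data_of_letters (fun j => coDressKBmAt (toSite r) Lc (KInvStep (d := d) Lc j))
      (SpureRecAt d Lc (toSite r) cE cVH cΛ) (M1At d Lc (toSite r) cΛ) cE₂ cB Tc hLc
      (fun j => decays_coDressKBmAt_KInvStep (d := d) hr j) (fun j => locStencil_SpureRecAt hLc hr cE cVH cΛ j)
      (fun j => ⟨_, 1, one_pos, vertexFamily_M1At hLc hr cΛ j zero_le_one⟩) hB (hmix_an1 hLc hr) j
  have hstep := unitS₂_T2RecOf_succ_eq_lin4_add (fun j => coDressKBmAt (toSite r) Lc (KInvStep (d := d) Lc j))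
      (SpureRecAt d Lc (toSite r) cE cVH cΛ) (M1At d Lc (toSite r) cΛ) cE₂ cB Tc vh₂S (mixFFAt (toSite r) Lc) hBff hBmm j hδ hK h₀ hW
  simp only [T2RecOf_comb] at hstep
  -- the member is bounded (its `LocStencil₂` shape)
  obtain ⟨CT, δT, hδT, hT⟩ := shape_member hLc hr cE cVH cΛ cE₂ cB Tc hB j
  rw [hstep, divW_add_apply, divW_lin4_comb hr j _ (bdd_of_locStencil₂ hT hδT.le) y ν y']
  exact add_comm _ _

/-! ## §2 Units: the block-summed slot divergences of the unit member, and their slaving by a raw table law -/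

omit [NeZero Lc] in
/-- [folklore] **THE BLOCK-SUMMED FIRST-SLOT DIVERGENCE OF A UNIT-NORMALISED TABLE IS THE UNIT-RESCALED BLOCK-SUMMED DIVERGENCE** (`divV` acts on the slot
index, `unitS₂ ∕ unitS` on the legs; any `sf sm`, any table, any finite set of fine sites). -/
theorem boxSum_divV_unitS₂_fst (sf sm : ℝ) (T : Tab d) (s : Finset (Fin (d + 1) → ℕ)) (p : (Fin (d + 1) → ℕ) → (Fin (d + 1) → ℤ))
    (κ' : Fin (d + 1)) (u' : Fin (d + 1) → ℤ) :
    ∑ v ∈ s, divV (fun κ u => unitS₂ sf sm T κ u κ' u') (p v)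
      = (sf * sm)⁻¹ • unitS sf sm (fun κ' u' => ∑ v ∈ s, divV (fun κ u => T κ u κ' u') (p v)) κ' u' := by
  funext x z a b
  simp only [Finset.sum_apply, KernelWard.divV, Pi.sub_apply, Pi.smul_apply, smul_eq_mul, unitS₂_apply, unitS_apply]
  simp only [Finset.sum_mul, Finset.mul_sum, mul_sub, sub_mul]

omit [NeZero Lc] in
/-- [folklore] The same for the SECOND slot: `Σ_v divV (unitS₂ sf sm T κ u) (p v) = (sf·sm)⁻¹ • unitS sf sm (κ u ↦ Σ_v divV (T κ u) (p v)) κ u`. -/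
theorem boxSum_divV_unitS₂_snd (sf sm : ℝ) (T : Tab d) (s : Finset (Fin (d + 1) → ℕ)) (p : (Fin (d + 1) → ℕ) → (Fin (d + 1) → ℤ))
    (κ : Fin (d + 1)) (u : Fin (d + 1) → ℤ) :
    ∑ v ∈ s, divV (unitS₂ sf sm T κ u) (p v)
      = (sf * sm)⁻¹ • unitS sf sm (fun κ u => ∑ v ∈ s, divV (T κ u) (p v)) κ u := by
  funext x z a b
  simp only [Finset.sum_apply, KernelWard.divV, Pi.sub_apply, Pi.smul_apply, smul_eq_mul, unitS₂_apply, unitS_apply]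
  simp only [Finset.sum_mul, Finset.mul_sum, mul_sub, sub_mul]

omit [NeZero Lc] in
/-- NOT IN PRINT; OUR BOOKKEEPING.  **THE FIRST-SLOT BLOCK-SUMMED DIVERGENCE OF THE UNIT MEMBER, SLAVED BY A TABLE LAW** (letters: a table `T`, its first-order
partner `S`, block generators `X Y`, a remainder `R`, a Ward constant `cH′ ≠ 0`; the law in the LITERAL shape of D1's `WardLocusQuarticTable.tableLaw_T2RecAt_succ ∕ _zero`):
IF `cH′ • Σ_{v∈box} divV (κ u ↦ T κ u κ′ u′) (Lc•Y + v) = S κ′ u′ ∘ X Y − X Y ∘ S κ′ u′ + R Y κ′ u′` for all `Y κ′ u′`, THEN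
`Σ_{v∈box} divV (κ u ↦ unitS₂ sf sm T κ u κ′ u′) (Lc•y + v) = (sf·sm)⁻¹ • unitS sf sm (κ′ u′ ↦ cH′⁻¹ • (S κ′ u′ ∘ X y − X y ∘ S κ′ u′ + R y κ′ u′)) κ′ u′` — the member is gone. -/
theorem boxSum_divV_unitS₂_fst_of_tableLaw (sf sm : ℝ) {T : Tab d} {S : Fin (d + 1) → (Fin (d + 1) → ℤ) → MKer (d + 1) (Fib d)}
    {X : (Fin (d + 1) → ℤ) → MKer (d + 1) (Fib d)} {R : (Fin (d + 1) → ℤ) → Fin (d + 1) → (Fin (d + 1) → ℤ) → MKer (d + 1) (Fib d)}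
    {cH' : ℝ} (hcH : cH' ≠ 0)
    (hTL : ∀ (Y : Fin (d + 1) → ℤ) (κ' : Fin (d + 1)) (u' : Fin (d + 1) → ℤ),
      cH' • ∑ v ∈ box (d + 1) Lc, divV (fun κ u => T κ u κ' u') ((Lc : ℤ) • Y + toSite v) = comp (S κ' u') (X Y) - comp (X Y) (S κ' u') + R Y κ' u')
    (y : Fin (d + 1) → ℤ) (κ' : Fin (d + 1)) (u' : Fin (d + 1) → ℤ) :
    ∑ v ∈ box (d + 1) Lc, divV (fun κ u => unitS₂ sf sm T κ u κ' u') ((Lc : ℤ) • y + toSite v)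
      = (sf * sm)⁻¹ • unitS sf sm (fun κ' u' => cH'⁻¹ • (comp (S κ' u') (X y) - comp (X y) (S κ' u') + R y κ' u')) κ' u' := by
  have e : (fun κ' u' => ∑ v ∈ box (d + 1) Lc, divV (fun κ u => T κ u κ' u') ((Lc : ℤ) • y + toSite v))
      = fun κ' u' => cH'⁻¹ • (comp (S κ' u') (X y) - comp (X y) (S κ' u') + R y κ' u') := by
    funext κ' u'
    rw [← hTL y κ' u', inv_smul_smul₀ hcH]
  rw [boxSum_divV_unitS₂_fst, e]

omit [NeZero Lc] in
/-- NOT IN PRINT; OUR BOOKKEEPING.  **THE SECOND-SLOT BLOCK-SUMMED DIVERGENCE OF THE UNIT MEMBER, SLAVED BY THE SECOND-SLOT TABLE LAW** (shape of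
`tableLaw_T2RecAt_succ'' ∕ _zero''`). -/
theorem boxSum_divV_unitS₂_snd_of_tableLaw (sf sm : ℝ) {T : Tab d} {S : Fin (d + 1) → (Fin (d + 1) → ℤ) → MKer (d + 1) (Fib d)}
    {X : (Fin (d + 1) → ℤ) → MKer (d + 1) (Fib d)} {R : (Fin (d + 1) → ℤ) → Fin (d + 1) → (Fin (d + 1) → ℤ) → MKer (d + 1) (Fib d)}
    {cH' : ℝ} (hcH : cH' ≠ 0)
    (hTL : ∀ (Y : Fin (d + 1) → ℤ) (κ : Fin (d + 1)) (u : Fin (d + 1) → ℤ),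
      cH' • ∑ v ∈ box (d + 1) Lc, divV (T κ u) ((Lc : ℤ) • Y + toSite v) = comp (S κ u) (X Y) - comp (X Y) (S κ u) + R Y κ u)
    (y : Fin (d + 1) → ℤ) (κ : Fin (d + 1)) (u : Fin (d + 1) → ℤ) :
    ∑ v ∈ box (d + 1) Lc, divV (unitS₂ sf sm T κ u) ((Lc : ℤ) • y + toSite v)
      = (sf * sm)⁻¹ • unitS sf sm (fun κ u => cH'⁻¹ • (comp (S κ u) (X y) - comp (X y) (S κ u) + R y κ u)) κ u := by
  have e : (fun κ u => ∑ v ∈ box (d + 1) Lc, divV (T κ u) ((Lc : ℤ) • y + toSite v))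
      = fun κ u => cH'⁻¹ • (comp (S κ u) (X y) - comp (X y) (S κ u) + R y κ u) := by
    funext κ u
    rw [← hTL y κ u, inv_smul_smul₀ hcH]
  rw [boxSum_divV_unitS₂_snd, e]

/-! ## §3 SLAVE-src: the composition with the two table laws of the raw member (letters) -/

/-- NOT IN PRINT; OUR BOOKKEEPING.  **SLAVE-src — THE SOURCE-SLOT DIVERGENCE OF THE DRESSED COMB MEMBER ONE LEVEL UP IS SLAVED TO LEVEL-`j` FIRST-ORDER DATA**
(every `j y ν y′`; in-block root, `1 ≤ Lc`; border data `hBff hBmm hB`).  HYPOTHESES (letters `S X R R″`, Ward constant `cH′ ≠ 0`): the two TABLE LAWS of the RAW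
member `T̃_j` in the literal conclusion shape of D1's `WardLocusQuarticTable.tableLaw_T2RecAt_succ ∕ ''` (j ≥ 1, under their `hWd ∕ hBord ∕ hlock`) resp.
`_zero ∕ ''` (j = 0, Wilson + border letters) — `hTL : cH′ • Σ_v divV (κ u ↦ T̃_j κ u κ′ u′) (Lc•Y + v) = S κ′ u′ ∘ X Y − X Y ∘ S κ′ u′ + R Y κ′ u′` and its second-slot
twin `hTL″`.  CONCLUSION: `divW (T♮̃_{j+1}) y ν y′ = divW (b♮̃_j) y ν y′ + (c·Lc^{−(d+1)}∕2) • (e3OfK Lc K♮ᴱ_j G₁ ν y′ + e3OfK Lc K♮ᴱ_j G₂ ν y′)` with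
`G₁ κ′ u′ := (sf_j·sm_j)⁻¹ • unitS sf_j sm_j (κ′ u′ ↦ cH′⁻¹ • (S κ′ u′ ∘ X y − X y ∘ S κ′ u′ + R y κ′ u′)) κ′ u′`, `G₂` the ″ twin — NO MEMBER ON THE RIGHT
(§1 + §2; the S-step `e3OfK` of leaf-03's T-EQ carries first-order data only). -/
theorem divW_member_succ_eq_slaved (hLc : 1 ≤ Lc) (hr : r ∈ box (d + 1) Lc) (cE cVH cΛ cE₂ cB : ℝ) (Tc : Fin 4 → Fin 4 → Fin 4 → Fin 4 → ℝ)
    {vh₂S : Tab d} (hBff : ∀ κ u κ' u' x z (α β : Fin (d + 1)), vh₂S κ u κ' u' x z (Sum.inl α) (Sum.inl β) = 0)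
    (hBmm : ∀ κ u κ' u' x z (μ ν : Fin (d + 1)), vh₂S κ u κ' u' x z (Sum.inr μ) (Sum.inr ν) = 0)
    (hB : ∃ C δ : ℝ, 0 < δ ∧ LocStencil₂ vh₂S C δ) (j : ℕ)
    {S : Fin (d + 1) → (Fin (d + 1) → ℤ) → MKer (d + 1) (Fib d)} {X : (Fin (d + 1) → ℤ) → MKer (d + 1) (Fib d)}
    {R R'' : (Fin (d + 1) → ℤ) → Fin (d + 1) → (Fin (d + 1) → ℤ) → MKer (d + 1) (Fib d)} {cH' : ℝ} (hcH : cH' ≠ 0)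
    (hTL : ∀ (Y : Fin (d + 1) → ℤ) (κ' : Fin (d + 1)) (u' : Fin (d + 1) → ℤ),
      cH' • ∑ v ∈ box (d + 1) Lc, divV (fun κ u => T2RecAt d Lc (toSite r) cE cVH cΛ cE₂ cB Tc vh₂S (mixFFAt (toSite r) Lc) j κ u κ' u') ((Lc : ℤ) • Y + toSite v)
        = comp (S κ' u') (X Y) - comp (X Y) (S κ' u') + R Y κ' u')
    (hTL'' : ∀ (Y : Fin (d + 1) → ℤ) (κ : Fin (d + 1)) (u : Fin (d + 1) → ℤ),
      cH' • ∑ v ∈ box (d + 1) Lc, divV (T2RecAt d Lc (toSite r) cE cVH cΛ cE₂ cB Tc vh₂S (mixFFAt (toSite r) Lc) j κ u) ((Lc : ℤ) • Y + toSite v)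
        = comp (S κ u) (X Y) - comp (X Y) (S κ u) + R'' Y κ u)
    (y : Fin (d + 1) → ℤ) (ν : Fin (d + 1)) (y' : Fin (d + 1) → ℤ) :
    divW (unitS₂ (sfStep Lc (j + 1)) (smStep d Lc (j + 1)) (T2RecAt d Lc (toSite r) cE cVH cΛ cE₂ cB Tc vh₂S (mixFFAt (toSite r) Lc) (j + 1))) y ν y'
      = divW (fun κ u κ' u' => (cE₂ * (Lc : ℝ) ^ (2 * (d + 1))) • mmRead Lc (K3OfK
            (unitK (sfStep Lc j) (smStep d Lc j) (coDressKBmAt (toSite r) Lc (KInvStep (d := d) Lc j))) Lc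
            (unitS (sfStep Lc j) (smStep d Lc j) (SpureRecAt d Lc (toSite r) cE cVH cΛ j)) (unitM (sfStep Lc j) (smStep d Lc j) (M1At d Lc (toSite r) cΛ j))
            (W2SymOfK (unitK (sfStep Lc j) (smStep d Lc j) (coDressKBmAt (toSite r) Lc (KInvStep (d := d) Lc j))) Lc
              (unitS (sfStep Lc j) (smStep d Lc j) (SpureRecAt d Lc (toSite r) cE cVH cΛ j)) (unitM (sfStep Lc j) (smStep d Lc j) (M1At d Lc (toSite r) cΛ j)) 0
              (unitM₂ (sfStep Lc j) (smStep d Lc j) (M2Of d Lc (mixFFAt (toSite r) Lc) j))) κ u κ' u') + cB • vh₂S κ u κ' u') y ν y'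
        + (cE₂ * (Lc : ℝ) ^ (2 * (d + 1)) * ((Lc : ℝ) ^ (d + 1))⁻¹ / 2) •
          (e3OfK Lc (unitK (sfStep Lc j) (smStep d Lc j) (coDressKBmAt (toSite r) Lc (KInvStep (d := d) Lc j)))
              (fun κ' u' => (sfStep Lc j * smStep d Lc j)⁻¹ • unitS (sfStep Lc j) (smStep d Lc j)
                (fun κ' u' => cH'⁻¹ • (comp (S κ' u') (X y) - comp (X y) (S κ' u') + R y κ' u')) κ' u') ν y'
            + e3OfK Lc (unitK (sfStep Lc j) (smStep d Lc j) (coDressKBmAt (toSite r) Lc (KInvStep (d := d) Lc j)))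
              (fun κ u => (sfStep Lc j * smStep d Lc j)⁻¹ • unitS (sfStep Lc j) (smStep d Lc j)
                (fun κ u => cH'⁻¹ • (comp (S κ u) (X y) - comp (X y) (S κ u) + R'' y κ u)) κ u) ν y') := by
  have e₁ : (fun κ' u' => ∑ v ∈ box (d + 1) Lc, divV (fun κ u => unitS₂ (sfStep Lc j) (smStep d Lc j) (T2RecAt d Lc (toSite r) cE cVH cΛ cE₂ cB Tc vh₂S (mixFFAt (toSite r) Lc) j) κ u κ' u') ((Lc : ℤ) • y + toSite v))
      = fun κ' u' => (sfStep Lc j * smStep d Lc j)⁻¹ • unitS (sfStep Lc j) (smStep d Lc j)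
          (fun κ' u' => cH'⁻¹ • (comp (S κ' u') (X y) - comp (X y) (S κ' u') + R y κ' u')) κ' u' :=
    funext fun κ' => funext fun u' => boxSum_divV_unitS₂_fst_of_tableLaw (sfStep Lc j) (smStep d Lc j) hcH hTL y κ' u'
  have e₂ : (fun κ u => ∑ v ∈ box (d + 1) Lc, divV (unitS₂ (sfStep Lc j) (smStep d Lc j) (T2RecAt d Lc (toSite r) cE cVH cΛ cE₂ cB Tc vh₂S (mixFFAt (toSite r) Lc) j) κ u) ((Lc : ℤ) • y + toSite v))
      = fun κ u => (sfStep Lc j * smStep d Lc j)⁻¹ • unitS (sfStep Lc j) (smStep d Lc j)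
          (fun κ u => cH'⁻¹ • (comp (S κ u) (X y) - comp (X y) (S κ u) + R'' y κ u)) κ u :=
    funext fun κ => funext fun u => boxSum_divV_unitS₂_snd_of_tableLaw (sfStep Lc j) (smStep d Lc j) hcH hTL'' y κ u
  rw [divW_member_succ_eq hLc hr cE cVH cΛ cE₂ cB Tc hBff hBmm hB j y ν y', e₁, e₂]

/-! ## §4 The instances at D1's literal table laws (pin `(cE, cVH) = (Lc^{d+1}, −Lc^{d+1}·½·Lc^{d+1})`; their hypotheses displayed verbatim) -/

/-- NOT IN PRINT; OUR BOOKKEEPING.  **SLAVE-src AT LEVEL `m+1 → m+2`** (pin; D1's `tableLaw_T2RecAt_succ ∕ ''` discharge the two table laws of the RAW member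
`T̃_{m+1}` under THEIR displayed hypotheses `h𝒩 hWd hlock hBord hBord''`; `cH′ ≠ 0` displayed). -/
theorem divW_member_succ_succ_eq_slaved (hLc : 1 ≤ Lc) (hr : r ∈ box (d + 1) Lc) (cΛ cE₂ cB : ℝ) (Tc : Fin 4 → Fin 4 → Fin 4 → Fin 4 → ℝ)
    {vh₂S : Tab d} (hBff : ∀ κ u κ' u' x z (α β : Fin (d + 1)), vh₂S κ u κ' u' x z (Sum.inl α) (Sum.inl β) = 0)
    (hBmm : ∀ κ u κ' u' x z (μ ν : Fin (d + 1)), vh₂S κ u κ' u' x z (Sum.inr μ) (Sum.inr ν) = 0)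
    (hB : ∃ C δ : ℝ, 0 < δ ∧ LocStencil₂ vh₂S C δ) (m : ℕ)
    {𝒩 : (Fin (d + 1) → ℤ) → Fin (d + 1) → (Fin (d + 1) → ℤ) → MKer (d + 1) (Fib d)} (h𝒩 : ∀ y ν y', Loc (𝒩 y ν y'))
    (hWd : ∀ (y : Fin (d + 1) → ℤ) (ν : Fin (d + 1)) (y' : Fin (d + 1) → ℤ),
      divW (WrecAt d Lc (toSite r) ((Lc : ℝ) ^ (d + 1)) (-((Lc : ℝ) ^ (d + 1) * (1 / 2) * (Lc : ℝ) ^ (d + 1))) cΛ cE₂ cB Tc vh₂S (mixFFAt (toSite r) Lc) m) y ν y' =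
        conjV (dM (coDressKBmAt (toSite r) Lc (KInvStep (d := d) Lc m)) Lc
            (SpureRecAt d Lc (toSite r) ((Lc : ℝ) ^ (d + 1)) (-((Lc : ℝ) ^ (d + 1) * (1 / 2) * (Lc : ℝ) ^ (d + 1))) cΛ m)
            (M1At d Lc (toSite r) cΛ m) ν y')
          (diagK (((1 : ℝ) / 2) • ∑ v ∈ box (d + 1) Lc, legInd (toSite r) ((Lc : ℤ) • y + toSite v))) + 𝒩 y ν y')
    {cH' : ℝ} (hcH : cH' ≠ 0) (hlock : cH' * (cE₂ * wV4 d Lc (m + 1)) * ((1 : ℝ) / 2) = ((Lc : ℝ) ^ (d + 1) * wE d Lc (m + 1)) * ((1 : ℝ) / 2))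
    {RB RB'' : (Fin (d + 1) → ℤ) → Fin (d + 1) → (Fin (d + 1) → ℤ) → MKer (d + 1) (Fib d)}
    (hBord : ∀ (Y : Fin (d + 1) → ℤ) (κ' : Fin (d + 1)) (u' : Fin (d + 1) → ℤ),
      cH' • ∑ v ∈ box (d + 1) Lc, divV (fun κ u => (cB * wB2 d Lc (m + 1)) • vh₂S κ u κ' u') ((Lc : ℤ) • Y + toSite v) =
        comp ((-((Lc : ℝ) ^ (d + 1) * (1 / 2) * (Lc : ℝ) ^ (d + 1)) * wVH d Lc (m + 1)) • vhSAt (toSite r) d Lc rfl κ' u')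
            (diagK (((1 : ℝ) / 2) • ∑ v ∈ box (d + 1) Lc, legInd (toSite r) ((Lc : ℤ) • Y + toSite v)))
          - comp (diagK (((1 : ℝ) / 2) • ∑ v ∈ box (d + 1) Lc, legInd (toSite r) ((Lc : ℤ) • Y + toSite v)))
            ((-((Lc : ℝ) ^ (d + 1) * (1 / 2) * (Lc : ℝ) ^ (d + 1)) * wVH d Lc (m + 1)) • vhSAt (toSite r) d Lc rfl κ' u')
          + RB Y κ' u')
    (hBord'' : ∀ (Y : Fin (d + 1) → ℤ) (κ : Fin (d + 1)) (u : Fin (d + 1) → ℤ),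
      cH' • ∑ v ∈ box (d + 1) Lc, divV (fun κ' u' => (cB * wB2 d Lc (m + 1)) • vh₂S κ u κ' u') ((Lc : ℤ) • Y + toSite v) =
        comp ((-((Lc : ℝ) ^ (d + 1) * (1 / 2) * (Lc : ℝ) ^ (d + 1)) * wVH d Lc (m + 1)) • vhSAt (toSite r) d Lc rfl κ u)
            (diagK (((1 : ℝ) / 2) • ∑ v ∈ box (d + 1) Lc, legInd (toSite r) ((Lc : ℤ) • Y + toSite v)))
          - comp (diagK (((1 : ℝ) / 2) • ∑ v ∈ box (d + 1) Lc, legInd (toSite r) ((Lc : ℤ) • Y + toSite v)))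
            ((-((Lc : ℝ) ^ (d + 1) * (1 / 2) * (Lc : ℝ) ^ (d + 1)) * wVH d Lc (m + 1)) • vhSAt (toSite r) d Lc rfl κ u)
          + RB'' Y κ u)
    (y : Fin (d + 1) → ℤ) (ν : Fin (d + 1)) (y' : Fin (d + 1) → ℤ) :
    divW (unitS₂ (sfStep Lc (m + 1 + 1)) (smStep d Lc (m + 1 + 1)) (T2RecAt d Lc (toSite r) ((Lc : ℝ) ^ (d + 1)) (-((Lc : ℝ) ^ (d + 1) * (1 / 2) * (Lc : ℝ) ^ (d + 1))) cΛ cE₂ cB Tc vh₂S (mixFFAt (toSite r) Lc) (m + 1 + 1))) y ν y'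
      = divW (fun κ u κ' u' => (cE₂ * (Lc : ℝ) ^ (2 * (d + 1))) • mmRead Lc (K3OfK
            (unitK (sfStep Lc (m + 1)) (smStep d Lc (m + 1)) (coDressKBmAt (toSite r) Lc (KInvStep (d := d) Lc (m + 1)))) Lc
            (unitS (sfStep Lc (m + 1)) (smStep d Lc (m + 1)) (SpureRecAt d Lc (toSite r) ((Lc : ℝ) ^ (d + 1)) (-((Lc : ℝ) ^ (d + 1) * (1 / 2) * (Lc : ℝ) ^ (d + 1))) cΛ (m + 1))) (unitM (sfStep Lc (m + 1)) (smStep d Lc (m + 1)) (M1At d Lc (toSite r) cΛ (m + 1)))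
            (W2SymOfK (unitK (sfStep Lc (m + 1)) (smStep d Lc (m + 1)) (coDressKBmAt (toSite r) Lc (KInvStep (d := d) Lc (m + 1)))) Lc
              (unitS (sfStep Lc (m + 1)) (smStep d Lc (m + 1)) (SpureRecAt d Lc (toSite r) ((Lc : ℝ) ^ (d + 1)) (-((Lc : ℝ) ^ (d + 1) * (1 / 2) * (Lc : ℝ) ^ (d + 1))) cΛ (m + 1))) (unitM (sfStep Lc (m + 1)) (smStep d Lc (m + 1)) (M1At d Lc (toSite r) cΛ (m + 1))) 0
              (unitM₂ (sfStep Lc (m + 1)) (smStep d Lc (m + 1)) (M2Of d Lc (mixFFAt (toSite r) Lc) (m + 1)))) κ u κ' u') + cB • vh₂S κ u κ' u') y ν y'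
        + (cE₂ * (Lc : ℝ) ^ (2 * (d + 1)) * ((Lc : ℝ) ^ (d + 1))⁻¹ / 2) •
          (e3OfK Lc (unitK (sfStep Lc (m + 1)) (smStep d Lc (m + 1)) (coDressKBmAt (toSite r) Lc (KInvStep (d := d) Lc (m + 1))))
              (fun κ' u' => (sfStep Lc (m + 1) * smStep d Lc (m + 1))⁻¹ • unitS (sfStep Lc (m + 1)) (smStep d Lc (m + 1))
                (fun κ' u' => cH'⁻¹ • (comp (SpureRecAt d Lc (toSite r) ((Lc : ℝ) ^ (d + 1)) (-((Lc : ℝ) ^ (d + 1) * (1 / 2) * (Lc : ℝ) ^ (d + 1))) cΛ (m + 1) κ' u') (diagK (((1 : ℝ) / 2) • ∑ v ∈ box (d + 1) Lc, legInd (toSite r) ((Lc : ℤ) • y + toSite v))) - comp (diagK (((1 : ℝ) / 2) • ∑ v ∈ box (d + 1) Lc, legInd (toSite r) ((Lc : ℤ) • y + toSite v))) (SpureRecAt d Lc (toSite r) ((Lc : ℝ) ^ (d + 1)) (-((Lc : ℝ) ^ (d + 1) * (1 / 2) * (Lc : ℝ) ^ (d + 1))) cΛ (m + 1) κ' u') +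 ((-(cH' * (cE₂ * wV4 d Lc (m + 1)))) • ∑ v ∈ box (d + 1) Lc, mmRead Lc (comp (comp (coDressKBmAt (toSite r) Lc (KInvStep (d := d) Lc m)) (𝒩 ((Lc : ℤ) • y + toSite v) κ' u')) (coDressKBmAt (toSite r) Lc (KInvStep (d := d) Lc m))) + RB y κ' u'))) κ' u') ν y'
            + e3OfK Lc (unitK (sfStep Lc (m + 1)) (smStep d Lc (m + 1)) (coDressKBmAt (toSite r) Lc (KInvStep (d := d) Lc (m + 1))))
              (fun κ u => (sfStep Lc (m + 1) * smStep d Lc (m + 1))⁻¹ • unitS (sfStep Lc (m + 1)) (smStep d Lc (m + 1))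
                (fun κ u => cH'⁻¹ • (comp (SpureRecAt d Lc (toSite r) ((Lc : ℝ) ^ (d + 1)) (-((Lc : ℝ) ^ (d + 1) * (1 / 2) * (Lc : ℝ) ^ (d + 1))) cΛ (m + 1) κ u) (diagK (((1 : ℝ) / 2) • ∑ v ∈ box (d + 1) Lc, legInd (toSite r) ((Lc : ℤ) • y + toSite v))) - comp (diagK (((1 : ℝ) / 2) • ∑ v ∈ box (d + 1) Lc, legInd (toSite r) ((Lc : ℤ) • y + toSite v))) (SpureRecAt d Lc (toSite r) ((Lc : ℝ) ^ (d + 1)) (-((Lc : ℝ) ^ (d + 1) * (1 / 2) * (Lc : ℝ) ^ (d + 1))) cΛ (m + 1) κ u) + ((-(cH' * (cE₂ * wV4 d Lc (m + 1)))) • ∑ v ∈ box (d + 1) Lc, mmRead Lc (comp (comp (coDressKBmAt (toSite r) Lc (KInvStep (d := d) Lc m)) (𝒩 ((Lc : ℤ) • y + toSite v) κ u)) (coDressKBmAt (toSite r) Lc (KInvStep (d := d) Lc m))) + RB'' y κ u))) κ u) ν y') :=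
  divW_member_succ_eq_slaved hLc hr ((Lc : ℝ) ^ (d + 1)) (-((Lc : ℝ) ^ (d + 1) * (1 / 2) * (Lc : ℝ) ^ (d + 1))) cΛ cE₂ cB Tc hBff hBmm hB (m + 1) hcH
    (tableLaw_T2RecAt_succ hLc hr cΛ cE₂ cB Tc hB (hmix_an1 hLc hr) m h𝒩 hWd hlock hBord)
    (tableLaw_T2RecAt_succ'' hLc hr cΛ cE₂ cB Tc hB (hmix_an1 hLc hr) m h𝒩 hWd hlock hBord'') y ν y'


/-- NOT IN PRINT; OUR BOOKKEEPING.  **SLAVE-src AT LEVEL `0 → 1`** (pin; D1's `tableLaw_T2RecAt_zero ∕ ''` discharge the two table laws of the RAW member `T̃_0`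
from the WILSON letters `hWil ∕ hWil''` and the BORDER letters `hBord ∕ hBord''`, displayed verbatim; remainders `RW + RB`, `RW'' + RB''`; `cH′ ≠ 0`). -/
theorem divW_member_one_eq_slaved (hLc : 1 ≤ Lc) (hr : r ∈ box (d + 1) Lc) (cΛ cE₂ cB : ℝ) (Tc : Fin 4 → Fin 4 → Fin 4 → Fin 4 → ℝ)
    {vh₂S : Tab d} (hBff : ∀ κ u κ' u' x z (α β : Fin (d + 1)), vh₂S κ u κ' u' x z (Sum.inl α) (Sum.inl β) = 0)
    (hBmm : ∀ κ u κ' u' x z (μ ν : Fin (d + 1)), vh₂S κ u κ' u' x z (Sum.inr μ) (Sum.inr ν) = 0)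
    (hB : ∃ C δ : ℝ, 0 < δ ∧ LocStencil₂ vh₂S C δ) {cH' : ℝ} (hcH : cH' ≠ 0)
    {RW RB RW'' RB'' : (Fin (d + 1) → ℤ) → Fin (d + 1) → (Fin (d + 1) → ℤ) → MKer (d + 1) (Fib d)}
    (hWil : ∀ (Y : Fin (d + 1) → ℤ) (κ' : Fin (d + 1)) (u' : Fin (d + 1) → ℤ),
      cH' • ∑ v ∈ box (d + 1) Lc, divV (fun κ u => cE₂ • wilsonW₂ d Tc κ u κ' u') ((Lc : ℤ) • Y + toSite v) =
        comp (((Lc : ℝ) ^ (d + 1)) • wilsonA d κ' u') (diagK (((1 : ℝ) / 2) • ∑ v ∈ box (d + 1) Lc, legInd (toSite r) ((Lc : ℤ) • Y + toSite v))) - comp (diagK (((1 : ℝ) / 2) • ∑ v ∈ box (d + 1) Lc, legInd (toSite r) ((Lc : ℤ) • Y + toSite v))) (((Lc : ℝ) ^ (d + 1)) • wilsonA d κ' u') + RW Y κ' u')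
    (hBord : ∀ (Y : Fin (d + 1) → ℤ) (κ' : Fin (d + 1)) (u' : Fin (d + 1) → ℤ),
      cH' • ∑ v ∈ box (d + 1) Lc, divV (fun κ u => cB • vh₂S κ u κ' u') ((Lc : ℤ) • Y + toSite v) =
        comp ((-((Lc : ℝ) ^ (d + 1) * (1 / 2) * (Lc : ℝ) ^ (d + 1))) • vhSAt (toSite r) d Lc rfl κ' u') (diagK (((1 : ℝ) / 2) • ∑ v ∈ box (d + 1) Lc, legInd (toSite r) ((Lc : ℤ) • Y + toSite v))) - comp (diagK (((1 : ℝ) / 2) • ∑ v ∈ box (d + 1) Lc, legInd (toSite r) ((Lc : ℤ) • Y + toSite v))) ((-((Lc : ℝ) ^ (d + 1) * (1 / 2) * (Lc : ℝ) ^ (d + 1))) • vhSAt (toSite r) d Lc rfl κ' u') + RB Y κ' u')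
    (hWil'' : ∀ (Y : Fin (d + 1) → ℤ) (κ : Fin (d + 1)) (u : Fin (d + 1) → ℤ),
      cH' • ∑ v ∈ box (d + 1) Lc, divV (fun κ' u' => cE₂ • wilsonW₂ d Tc κ u κ' u') ((Lc : ℤ) • Y + toSite v) =
        comp (((Lc : ℝ) ^ (d + 1)) • wilsonA d κ u) (diagK (((1 : ℝ) / 2) • ∑ v ∈ box (d + 1) Lc, legInd (toSite r) ((Lc : ℤ) • Y + toSite v))) - comp (diagK (((1 : ℝ) / 2) • ∑ v ∈ box (d + 1) Lc, legInd (toSite r) ((Lc : ℤ) • Y + toSite v))) (((Lc : ℝ) ^ (d + 1)) • wilsonA d κ u) + RW'' Y κ u)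
    (hBord'' : ∀ (Y : Fin (d + 1) → ℤ) (κ : Fin (d + 1)) (u : Fin (d + 1) → ℤ),
      cH' • ∑ v ∈ box (d + 1) Lc, divV (fun κ' u' => cB • vh₂S κ u κ' u') ((Lc : ℤ) • Y + toSite v) =
        comp ((-((Lc : ℝ) ^ (d + 1) * (1 / 2) * (Lc : ℝ) ^ (d + 1))) • vhSAt (toSite r) d Lc rfl κ u) (diagK (((1 : ℝ) / 2) • ∑ v ∈ box (d + 1) Lc, legInd (toSite r) ((Lc : ℤ) • Y + toSite v))) - comp (diagK (((1 : ℝ) / 2) • ∑ v ∈ box (d + 1) Lc, legInd (toSite r) ((Lc : ℤ) • Y + toSite v))) ((-((Lc : ℝ) ^ (d + 1) * (1 / 2) * (Lc : ℝ) ^ (d + 1))) • vhSAt (toSite r) d Lc rfl κ u) + RB'' Y κ u)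
    (y : Fin (d + 1) → ℤ) (ν : Fin (d + 1)) (y' : Fin (d + 1) → ℤ) :
    divW (unitS₂ (sfStep Lc (0 + 1)) (smStep d Lc (0 + 1)) (T2RecAt d Lc (toSite r) ((Lc : ℝ) ^ (d + 1)) (-((Lc : ℝ) ^ (d + 1) * (1 / 2) * (Lc : ℝ) ^ (d + 1))) cΛ cE₂ cB Tc vh₂S (mixFFAt (toSite r) Lc) (0 + 1))) y ν y'
      = divW (fun κ u κ' u' => (cE₂ * (Lc : ℝ) ^ (2 * (d + 1))) • mmRead Lc (K3OfK
            (unitK (sfStep Lc 0) (smStep d Lc 0) (coDressKBmAt (toSite r) Lc (KInvStep (d := d) Lc 0))) Lc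
            (unitS (sfStep Lc 0) (smStep d Lc 0) (SpureRecAt d Lc (toSite r) ((Lc : ℝ) ^ (d + 1)) (-((Lc : ℝ) ^ (d + 1) * (1 / 2) * (Lc : ℝ) ^ (d + 1))) cΛ 0)) (unitM (sfStep Lc 0) (smStep d Lc 0) (M1At d Lc (toSite r) cΛ 0))
            (W2SymOfK (unitK (sfStep Lc 0) (smStep d Lc 0) (coDressKBmAt (toSite r) Lc (KInvStep (d := d) Lc 0))) Lc
              (unitS (sfStep Lc 0) (smStep d Lc 0) (SpureRecAt d Lc (toSite r) ((Lc : ℝ) ^ (d + 1)) (-((Lc : ℝ) ^ (d + 1) * (1 / 2) * (Lc : ℝ) ^ (d + 1))) cΛ 0)) (unitM (sfStep Lc 0) (smStep d Lc 0) (M1At d Lc (toSite r) cΛ 0)) 0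
              (unitM₂ (sfStep Lc 0) (smStep d Lc 0) (M2Of d Lc (mixFFAt (toSite r) Lc) 0))) κ u κ' u') + cB • vh₂S κ u κ' u') y ν y'
        + (cE₂ * (Lc : ℝ) ^ (2 * (d + 1)) * ((Lc : ℝ) ^ (d + 1))⁻¹ / 2) •
          (e3OfK Lc (unitK (sfStep Lc 0) (smStep d Lc 0) (coDressKBmAt (toSite r) Lc (KInvStep (d := d) Lc 0)))
              (fun κ' u' => (sfStep Lc 0 * smStep d Lc 0)⁻¹ • unitS (sfStep Lc 0) (smStep d Lc 0)
                (fun κ' u' => cH'⁻¹ • (comp (SpureRecAt d Lc (toSite r) ((Lc : ℝ) ^ (d + 1)) (-((Lc : ℝ) ^ (d + 1) * (1 / 2) * (Lc : ℝ) ^ (d + 1))) cΛ 0 κ' u') (diagK (((1 : ℝ) / 2) • ∑ v ∈ box (d + 1) Lc, legInd (toSite r) ((Lc : ℤ) • y + toSite v))) - comp (diagK (((1 : ℝ) / 2) • ∑ v ∈ box (d + 1) Lc, legInd (toSite r) ((Lc : ℤ) • y + toSite v))) (SpureRecAt d Lc (toSite r) ((Lc : ℝ) ^ (d + 1)) (-((Lc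 : ℝ) ^ (d + 1) * (1 / 2) * (Lc : ℝ) ^ (d + 1))) cΛ 0 κ' u') + (RW y κ' u' + RB y κ' u'))) κ' u') ν y'
            + e3OfK Lc (unitK (sfStep Lc 0) (smStep d Lc 0) (coDressKBmAt (toSite r) Lc (KInvStep (d := d) Lc 0)))
              (fun κ u => (sfStep Lc 0 * smStep d Lc 0)⁻¹ • unitS (sfStep Lc 0) (smStep d Lc 0)
                (fun κ u => cH'⁻¹ • (comp (SpureRecAt d Lc (toSite r) ((Lc : ℝ) ^ (d + 1)) (-((Lc : ℝ) ^ (d + 1) * (1 / 2) * (Lc : ℝ) ^ (d + 1))) cΛ 0 κ u) (diagK (((1 : ℝ) / 2) • ∑ v ∈ box (d + 1) Lc, legInd (toSite r) ((Lc : ℤ) • y + toSite v))) - comp (diagK (((1 : ℝ) / 2) • ∑ v ∈ box (d + 1) Lc, legInd (toSite r) ((Lc : ℤ) • y + toSite v))) (SpureRecAt d Lc (toSite r) ((Lc : ℝ) ^ (d + 1)) (-((Lc : ℝ) ^ (d + 1) * (1 / 2) * (Lc : ℝ) ^ (d + 1))) cΛ 0 κ u) + (RW'' y κ u + RB'' y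 κ u))) κ u) ν y') :=
  divW_member_succ_eq_slaved hLc hr ((Lc : ℝ) ^ (d + 1)) (-((Lc : ℝ) ^ (d + 1) * (1 / 2) * (Lc : ℝ) ^ (d + 1))) cΛ cE₂ cB Tc hBff hBmm hB 0 hcH
    (tableLaw_T2RecAt_zero cΛ cE₂ cB Tc vh₂S (mixFFAt (toSite r) Lc) hWil hBord)
    (tableLaw_T2RecAt_zero'' cΛ cE₂ cB Tc vh₂S (mixFFAt (toSite r) Lc) hWil'' hBord'') y ν y'

end Summit.QuantumFields.BalabanUV.Beta.GAN24.T2SlavedDivergence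

end
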